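import Summits.AnomalousDissipation.AnomalousDissipation.Theorems.BaireTransferDenseLoudDesignerForcesErgodicClosedOrbitFrame
import Summits.AnomalousDissipation.AnomalousDissipation.Theorems.BaireTransferDenseLoudDesignerForcesErgodicVDataExistence
import Literature.Analysis.FluidPDE.TorusClassicalNSForcedLocalExistence
import Literature.Analysis.FunctionSpaces.TorusClassicalNSConcatenation

/-!
# Tube orbits of the model map are classical Navier–Stokes trajectories for positive times (registered tools stub S6h
# `stub_tubeOrbitClassicalTools` of block N, line `ergodic-budget-selection-closing`, crux `BaireTransfer.DenseLoudDesignerForces`,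
# stmt-AnomalousDissipation-1143)

Summit-side assembly over the ACCEPTED definitions `ModelFrame`, `ModelFrame.IsMild`, `ModelFrame.modelMap`
(`…ErgodicModelDefs.lean`), the S6b bookkeeping (`…ErgodicModelSemigroup.lean`), the identification tools of
`…ErgodicClosedOrbitFrame.lean` (`stub_mildOrbitIdentificationTools`, `ModelFrame.eGradNormSq_rep_le`), the `V`-data
existence theorem E7 (`stub_vDataExistenceTools`), the forced local existence from the zero datum
(`Torus.exists_classicalNS_forced_zero_datum`, which anchors E7 without any background hypothesis) and the gluing of
classical solutions along open overlaps (`Torus.IsClassicalNSSolutionOn.glue_Ioo`):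

* `ModelFrame.exists_vDataLauncher` — UNIFORM LAUNCHER: for a bound `B` there are `T₇ > 0` and `E₂` such that from the
  physical state `rep (F.S x)` of every frame vector `‖x‖ ≤ B` a classical mean-zero solution of NS_ν(f_c) issues on
  `(0, T₇]` with `‖∇u‖₂² ≤ E₂`, attaining the state in `L²` and `Ḣ¹` (E7 at the level `E₁ = B²`, `‖∇ rep(F.S x)‖₂² ≤ ‖x‖²`);
* `ModelFrame.exists_classical_of_isMild` — CORE: every mild solution `ζ` on `[0, H]` bounded by `B` is, on `(0, H]`, the
  frame curve of a classical mean-zero solution with `‖∇u‖₂² ≤ E₂` attaining `rep (F.S (ζ 0))` (launch from `ζ(nρ)`,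
  `ρ = T₇/2`, identify each piece with the orbit by `stub_mildOrbitIdentificationTools`, glue consecutive pieces on the open
  overlaps where both are identified — induction on `n`);
* `stub_tubeOrbitClassicalTools` — the REGISTERED tools stub S6h: with the tube property of S6a, the model orbit of every
  `y ∈ U` on `(0, 3]`;
* `ModelFrame.exists_classical_of_orbit` — the same for orbit segments staying in `U` up to any time `T`
  (`exists_isMild_of_forall_modelMap_mem`).

References: J. C. Robinson, J. L. Rodrigo, W. Sadowski, *The Three-Dimensional Navier–Stokes Equations* (CUP 2016),
Thm 6.8, §8.1 (restart and identification on overlaps); D. Henry, *Geometric Theory of Semilinear Parabolic Equations*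
(1981), Thm. 3.3.3, 3.4.1.  Nothing is asserted; no definition is added.
-/

set_option linter.dupNamespace false

noncomputable section

open Set Function MeasureTheory Filter
open scoped InnerProductSpace Topology ENNReal

namespace Summit.AnomalousDissipation.AnomalousDissipation.Theorems.DenseLoudDesignerForces.Ergodic

open Literature.Analysis.FunctionSpaces Literature.Analysis.FunctionSpaces.Torus
open Literature.Analysis.FluidPDE Literature.Analysis.FluidPDE.Torus
open Summit.AnomalousDissipation.AnomalousDissipation.Theses.BaireTransfer
open Summit.AnomalousDissipation.AnomalousDissipation.Theorems.DenseLoudDesignerForces.Negative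

namespace ModelFrame

/-! ## The uniform launcher -/

/-- **Uniform `V`-data launcher for frame states.**  For `ν > 0`, a model frame with the designer force and a bound `B`
there are `T₇ > 0` and `E₂` such that for every `x ∈ H` with `‖x‖ ≤ B` a classical solution `(u, p)` of NS_ν(f_c) on
`(0, T₇] × T³` with mean-zero slices and `‖∇u(t)‖₂² ≤ E₂` attains `rep (F.S x)` in `L²` and in `Ḣ¹` as `t → 0⁺`: E7
(`stub_vDataExistenceTools`) at the level `E₁ = B²` (`‖∇ rep(F.S x)‖₂² ≤ ‖x‖²`, `ModelFrame.eGradNormSq_rep_le`), anchored at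
the forced local solution from the zero datum (`Torus.exists_classicalNS_forced_zero_datum`). [folklore] -/
theorem exists_vDataLauncher {S : Finset (Fin 3 → ℤ)} {c : ↥S → (EuclideanSpace ℂ (Fin 3))} {ν : ℝ} (hν : 0 < ν)
    (F : ModelFrame) (B : ℝ) :
    ∃ T₇ E₂ : ℝ, 0 < T₇ ∧ ∀ x : Hsp, ‖x‖ ≤ B →
      ∃ (u : ℝ → (UnitAddTorus (Fin 3)) → (EuclideanSpace ℝ (Fin 3))) (p : ℝ → (UnitAddTorus (Fin 3)) → ℝ),
        IsClassicalNSSolutionOn (Ioc 0 T₇) ν (fun _ => force S c) u p ∧ (∀ t ∈ Ioc 0 T₇, HasZeroMean (u t)) ∧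
        (∀ t ∈ Ioc 0 T₇, gradNormSq (u t) ≤ E₂) ∧
        Tendsto (fun t => ∫ ξ, ‖u t ξ - rep (F.S x) ξ‖ ^ 2) (𝓝[>] 0) (𝓝 0) ∧
        Tendsto (fun t => eGradNormSq (u t - rep (F.S x))) (𝓝[>] 0) (𝓝 0) := by
  obtain ⟨hFs, hFd, hFm⟩ := stub_designerForceTools S c
  -- the background: the forced local solution from the zero datum
  obtain ⟨L, hL, ū, pbar, hū, -, hūmean, -⟩ := exists_classicalNS_forced_zero_datum (d := Fin 3) hν hFs hFm
  have hū' : IsClassicalNSSolutionOn (Icc 0 L) ν (fun _ => realTrigPoly S (fun k => lerayCoeff k (coeffExt S c k))) ū pbar :=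
    hū
  obtain ⟨T₇, Y, hT₇, -, hE7⟩ := stub_vDataExistenceTools hν S (fun k => lerayCoeff k (coeffExt S c k)) hFd hFm hL hū'
    hūmean (B ^ 2) (sq_nonneg B)
  refine ⟨T₇, 2 * B ^ 2 + 2, hT₇, fun x hx => ?_⟩
  have hlev : eGradNormSq (rep (F.S x)) ≤ ENNReal.ofReal (B ^ 2) :=
    (F.eGradNormSq_rep_le x).trans (ENNReal.ofReal_le_ofReal (pow_le_pow_left₀ (norm_nonneg _) hx 2))
  obtain ⟨u, p, hsol, hmean, hgrad, -, h0, h1⟩ := hE7 (F.S x) hlev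
  exact ⟨u, p, hsol, hmean, hgrad, h0, h1⟩

/-! ## The core: bounded mild solutions are frame curves of classical trajectories -/

/-- **Bounded mild solutions are the frame curves of classical trajectories for positive times.**  For `ν > 0`, a model
frame with the designer force (`F.S xF = [f_c]`) and a bound `B` there is `E₂` such that: every mild solution `ζ` of the
frame-conjugated equation on `[0, H]`, `H > 0`, from `y` with `‖ζ r‖ ≤ B` is, on `(0, H]`, the frame curve of a classical
solution `(u, p)` of NS_ν(f_c) with mean-zero slices and `‖∇u(t)‖₂² ≤ E₂`, `F.S (ζ t) = [u t]`, attaining `rep (F.S y)` in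
`L²` and `Ḣ¹` at `0⁺`.  Proof: with the uniform launcher (`T₇`, `E₂`) and `ρ = T₇/2`, launch from the states `F.S (ζ(nρ))`,
identify each piece with `ζ(nρ + ·)` (`stub_mildOrbitIdentificationTools` for the shifted orbit), and glue consecutive pieces
(`glue_Ioo`) on the open overlaps `(nρ + ρ, min (nρ + T₇) H)` where both are identified with the orbit — induction on the
number of pieces (Robinson–Rodrigo–Sadowski 2016, §8.1). [folklore] -/
theorem exists_classical_of_isMild {S : Finset (Fin 3 → ℤ)} {c : ↥S → (EuclideanSpace ℂ (Fin 3))} {ν : ℝ} (hν : 0 < ν)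
    (F : ModelFrame) (xF : Hsp) (hxF : F.S xF = stateOf (force S c)) (B : ℝ) :
    ∃ E₂ : ℝ, ∀ {H : ℝ} (hH : 0 < H) {y : Hsp} {ζ : C(Icc (0 : ℝ) H, Hsp)}, F.IsMild ν xF hH.le y ζ → (∀ r, ‖ζ r‖ ≤ B) →
      ∃ (u : ℝ → (UnitAddTorus (Fin 3)) → (EuclideanSpace ℝ (Fin 3))) (p : ℝ → (UnitAddTorus (Fin 3)) → ℝ),
        IsClassicalNSSolutionOn (Ioc 0 H) ν (fun _ => force S c) u p ∧ (∀ t ∈ Ioc 0 H, HasZeroMean (u t)) ∧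
        (∀ t ∈ Ioc 0 H, gradNormSq (u t) ≤ E₂) ∧
        (∀ (t : ℝ) (ht : t ∈ Ioc 0 H), F.S (ζ ⟨t, ht.1.le, ht.2⟩) = stateOf (u t)) ∧
        Tendsto (fun t => ∫ ξ, ‖u t ξ - rep (F.S y) ξ‖ ^ 2) (𝓝[>] 0) (𝓝 0) ∧
        Tendsto (fun t => eGradNormSq (u t - rep (F.S y))) (𝓝[>] 0) (𝓝 0) := by
  obtain ⟨T₇, E₂, hT₇, hlaunch⟩ := F.exists_vDataLauncher (S := S) (c := c) hν B
  refine ⟨E₂, fun {H} hH {y} {ζ} hζ hζB => ?_⟩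
  set ρ : ℝ := T₇ / 2 with hρ
  have hρ0 : 0 < ρ := half_pos hT₇
  have hρT : ρ < T₇ := half_lt_self hT₇
  have hT₇ρ : T₇ = ρ + ρ := by rw [hρ]; ring
  -- identification of a piece launched from `ζ a` with the orbit
  have hid : ∀ (a : ℝ) (ha : a ∈ Icc 0 H) (w : ℝ → (UnitAddTorus (Fin 3)) → (EuclideanSpace ℝ (Fin 3)))
      (q : ℝ → (UnitAddTorus (Fin 3)) → ℝ), IsClassicalNSSolutionOn (Ioc 0 T₇) ν (fun _ => force S c) w q →
      (∀ t ∈ Ioc 0 T₇, HasZeroMean (w t)) → (∀ t ∈ Ioc 0 T₇, gradNormSq (w t) ≤ E₂) →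
      Tendsto (fun t => ∫ ξ, ‖w t ξ - rep (F.S (ζ ⟨a, ha⟩)) ξ‖ ^ 2) (𝓝[>] 0) (𝓝 0) →
      Tendsto (fun t => eGradNormSq (w t - rep (F.S (ζ ⟨a, ha⟩)))) (𝓝[>] 0) (𝓝 0) →
      ∀ (t : ℝ) (hat : a < t), t ≤ a + T₇ → ∀ htH : t ≤ H,
        F.S (ζ ⟨t, ha.1.trans hat.le, htH⟩) = stateOf (w (t - a)) := by
    intro a ha w q hw hwm hwM h0 h1 t hat htT htH
    obtain ⟨ζ', hζ', hζ'eq⟩ := hζ.shift hν ha.1 (sub_nonneg.2 ha.2) (sub_add_cancel H a)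
    have hB' : ∀ r, ‖ζ' r‖ ≤ B := fun r => by rw [hζ'eq]; exact hζB _
    have h := stub_mildOrbitIdentificationTools hν F xF hxF (sub_nonneg.2 ha.2) hT₇ hζ' hB' hw hwm hwM h0 h1 (t - a)
      ⟨sub_nonneg.2 hat.le, by linarith⟩ ⟨sub_pos.2 hat, by linarith⟩
    rw [hζ'eq, projIcc_of_mem hH.le ⟨by linarith [ha.1], by linarith⟩] at h
    have e : (⟨a + (t - a), by linarith [ha.1], by linarith⟩ : Icc (0 : ℝ) H) = ⟨t, ha.1.trans hat.le, htH⟩ :=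
      Subtype.ext (by push_cast; ring)
    rwa [e] at h
  -- the first piece, from `y = ζ 0`
  have h0mem : (0 : ℝ) ∈ Icc 0 H := ⟨le_rfl, hH.le⟩
  have hζ0 : ζ ⟨0, h0mem⟩ = y := hζ.apply_zero
  obtain ⟨w₀, q₀, hw₀, hw₀m, hw₀M, hw₀0, hw₀1⟩ := hlaunch (ζ ⟨0, h0mem⟩) (hζB _)
  have hid₀ := hid 0 h0mem w₀ q₀ hw₀ hw₀m hw₀M hw₀0 hw₀1
  rw [hζ0] at hw₀0 hw₀1
  -- induction on the number of pieces
  have claim : ∀ n : ℕ, (n : ℝ) * ρ < H →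
      ∃ (u : ℝ → (UnitAddTorus (Fin 3)) → (EuclideanSpace ℝ (Fin 3))) (p : ℝ → (UnitAddTorus (Fin 3)) → ℝ),
        IsClassicalNSSolutionOn (Ioo 0 (n * ρ + T₇)) ν (fun _ => force S c) u p ∧
        (∀ t ∈ Ioo 0 (n * ρ + T₇), HasZeroMean (u t) ∧ gradNormSq (u t) ≤ E₂) ∧
        (∀ (t : ℝ) (ht : t ∈ Ioo 0 (n * ρ + T₇)) (htH : t ≤ H), F.S (ζ ⟨t, ht.1.le, htH⟩) = stateOf (u t)) ∧
        ∀ t ∈ Ioo 0 ρ, u t = w₀ t := by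
    intro n
    induction n with
    | zero =>
      intro _
      refine ⟨w₀, q₀, ?_, fun t ht => ?_, fun t ht htH => ?_, fun t _ => rfl⟩
      · simp only [Nat.cast_zero, zero_mul, zero_add]
        exact hw₀.mono Ioo_subset_Ioc_self (isOpen_Ioo.uniqueDiffOn)
      · simp only [Nat.cast_zero, zero_mul, zero_add] at ht
        exact ⟨hw₀m t ⟨ht.1, ht.2.le⟩, hw₀M t ⟨ht.1, ht.2.le⟩⟩
      · simp only [Nat.cast_zero, zero_mul, zero_add] at ht
        have h := hid₀ t ht.1 (by linarith [ht.2]) htH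
        rwa [sub_zero] at h
    | succ n ih =>
      intro hn
      simp only [Nat.cast_add, Nat.cast_one] at hn ⊢
      have hn' : (n : ℝ) * ρ < H := by nlinarith [hρ0]
      obtain ⟨u₁, p₁, hu₁, hu₁b, hu₁id, hu₁0⟩ := ih hn'
      -- the new piece, launched from `ζ ((n + 1) ρ)`
      set a : ℝ := (n + 1) * ρ with ha_def
      have ha0 : 0 ≤ a := by positivity
      have ha : a ∈ Icc 0 H := ⟨ha0, hn.le⟩
      obtain ⟨w, q, hw, hwm, hwM, hw0, hw1⟩ := hlaunch (ζ ⟨a, ha⟩) (hζB _)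
      have hidw := hid a ha w q hw hwm hwM hw0 hw1
      -- its time translate on `(a, a + T₇)`
      have hu₂ : IsClassicalNSSolutionOn (Ioo a (a + T₇)) ν (fun _ => force S c) (fun t => w (t - a))
          fun t => q (t - a) :=
        (hw.comp_sub_const a).mono (fun t ht => ⟨by linarith [ht.1], by linarith [ht.2]⟩) isOpen_Ioo.uniqueDiffOn
      -- the switch time and the agreement on the open overlap
      set Ts : ℝ := min (n * ρ + T₇) H with hTs
      have haT : a < Ts := lt_min (by rw [ha_def, hT₇ρ]; nlinarith [hρ0]) hn
      have hTb : Ts ≤ a + T₇ := (min_le_left _ _).trans (by rw [ha_def]; nlinarith [hρ0, hT₇])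
      have heq : ∀ t ∈ Ioo a Ts, u₁ t = w (t - a) := by
        intro t ht
        have ht₁ : t ∈ Ioo 0 (n * ρ + T₇) := ⟨ha0.trans_lt ht.1, ht.2.trans_le (min_le_left _ _)⟩
        have htH : t ≤ H := (ht.2.trans_le (min_le_right _ _)).le
        have hs : t - a ∈ Ioc 0 T₇ := ⟨sub_pos.2 ht.1, by linarith [ht.2.trans_le hTb]⟩
        have e := (hu₁id t ht₁ htH).symm.trans (hidw t ht.1 (by linarith [hs.2]) htH)
        exact eq_of_stateOf_eq (hu₁.smooth_velocity.isSmooth_slice ht₁) (hu₁.divFree t ht₁) (hu₁b t ht₁).1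
          (hw.smooth_velocity.isSmooth_slice hs) (hw.divFree _ hs) (hwm _ hs) e
      have hc : Ts ≤ (n : ℝ) * ρ + T₇ := min_le_left _ _
      have hglue := (hu₁.mono (Ioo_subset_Ioo_right hc) isOpen_Ioo.uniqueDiffOn).glue_Ioo hu₂ ha0 haT hTb heq 0
      refine ⟨fun t => if t < Ts then u₁ t else w (t - a),
        fun t => if t < Ts then (fun x => p₁ t x - p₁ t 0) else fun x => q (t - a) x - q (t - a) 0,
        ?_, fun t ht => ?_, fun t ht htH => ?_, fun t ht => ?_⟩
      · have e : a + T₇ = (n + 1) * ρ + T₇ := by rw [ha_def]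
        rw [← e]
        exact hglue
      · by_cases htT : t < Ts
        · simp only [if_pos htT]
          exact hu₁b t ⟨ht.1, htT.trans_le hc⟩
        · simp only [if_neg htT]
          have hs : t - a ∈ Ioc 0 T₇ := ⟨sub_pos.2 (haT.trans_le (not_lt.1 htT)), by rw [ha_def]; linarith [ht.2]⟩
          exact ⟨hwm _ hs, hwM _ hs⟩
      · by_cases htT : t < Ts
        · simp only [if_pos htT]
          exact hu₁id t ⟨ht.1, htT.trans_le hc⟩ htH
        · simp only [if_neg htT]
          have hat : a < t := haT.trans_le (not_lt.1 htT)
          exact hidw t hat (by rw [ha_def]; linarith [ht.2]) htH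
      · have htT : t < Ts := by
          refine lt_of_lt_of_le ht.2 (le_trans ?_ haT.le)
          rw [ha_def]; nlinarith [hρ0]
        simp only [if_pos htT]
        exact hu₁0 t ht
  -- the number of pieces
  have hex : ∃ N : ℕ, H ≤ ((N : ℝ) + 1) * ρ := by
    obtain ⟨N, hN⟩ := exists_nat_ge (H / ρ)
    refine ⟨N, ?_⟩
    rw [div_le_iff₀ hρ0] at hN
    nlinarith [hρ0]
  classical
  let n₀ := Nat.find hex
  have hn₀ : H ≤ ((n₀ : ℝ) + 1) * ρ := Nat.find_spec hex
  have hn₀' : (n₀ : ℝ) * ρ < H := by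
    rcases Nat.eq_zero_or_pos n₀ with h0 | hpos
    · rw [h0, Nat.cast_zero, zero_mul]; exact hH
    · have hm : ¬ H ≤ ((n₀ - 1 : ℕ) + 1 : ℝ) * ρ := Nat.find_min hex (Nat.sub_lt hpos one_pos)
      rw [Nat.cast_sub hpos, Nat.cast_one, sub_add_cancel] at hm
      exact not_le.1 hm
  obtain ⟨u, p, hu, hub, huid, hu0⟩ := claim n₀ hn₀'
  have hsub : Ioc 0 H ⊆ Ioo 0 (n₀ * ρ + T₇) := fun t ht =>
    ⟨ht.1, ht.2.trans_lt (by rw [hT₇ρ]; nlinarith [hρ0])⟩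
  refine ⟨u, p, hu.mono hsub (uniqueDiffOn_Ioc 0 H), fun t ht => (hub t (hsub ht)).1, fun t ht => (hub t (hsub ht)).2,
    fun t ht => huid t (hsub ht) ht.2, ?_, ?_⟩
  · have he : ∀ᶠ t in 𝓝[>] (0 : ℝ), ∫ ξ, ‖w₀ t ξ - rep (F.S y) ξ‖ ^ 2 = ∫ ξ, ‖u t ξ - rep (F.S y) ξ‖ ^ 2 :=
      eventually_of_mem (Ioo_mem_nhdsGT hρ0) fun t ht => by rw [hu0 t ht]
    exact hw₀0.congr' he
  · have he : ∀ᶠ t in 𝓝[>] (0 : ℝ), eGradNormSq (w₀ t - rep (F.S y)) = eGradNormSq (u t - rep (F.S y)) :=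
      eventually_of_mem (Ioo_mem_nhdsGT hρ0) fun t ht => by rw [hu0 t ht]
    exact hw₀1.congr' he

end ModelFrame

/-! ## The registered tools stub S6h and the orbit-segment variant -/

/-- **Tools stub S6h — TUBE ORBITS ARE CLASSICAL FOR POSITIVE TIMES.**  With the tube property of S6a (`U ⊆ U'`, `U'`
bounded, admissible mild solutions from `U` on `[0, t]`, `t ≤ 3`, computing the model map) and the designer force, there
is a uniform level `E₂` such that the model orbit of every `y ∈ U` is, on `(0, 3]`, the frame image of a classical
mean-zero solution `(u, p)` of NS_ν(f_c) with `‖∇u(t)‖₂² ≤ E₂`, attaining `rep (F.S y)` in `L²` and `Ḣ¹` as `t → 0⁺`.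
Proof: the admissible solution `ζ` on `[0, 3]` from `y` computes `g t y = ζ t` for all `t ≤ 3` (restriction +
`modelMap_eq_of_isMild`) and is bounded by the bound of `U'`; apply `ModelFrame.exists_classical_of_isMild`. [folklore] -/
theorem stub_tubeOrbitClassicalTools {S : Finset (Fin 3 → ℤ)} {c : ↥S → (EuclideanSpace ℂ (Fin 3))} {ν : ℝ} (hν : 0 < ν)
    (F : ModelFrame) (xF : Hsp) (hxF : F.S xF = stateOf (force S c)) {U U' : Set Hsp} (hU' : IsOpen U')
    (hbdd : Bornology.IsBounded U') (hUU' : U ⊆ U')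
    (htube : ∀ y ∈ U, ∀ t ∈ Icc (0 : ℝ) 3, ∃ (ht : 0 ≤ t) (z : C(Icc (0 : ℝ) t, Hsp)),
      F.IsMild ν xF ht y z ∧ (∀ r, z r ∈ U') ∧ F.modelMap ν xF U' t y = z ⟨t, ht, le_rfl⟩) :
    ∃ E₂ : ℝ, ∀ y ∈ U, ∃ (u : ℝ → (UnitAddTorus (Fin 3)) → (EuclideanSpace ℝ (Fin 3))) (p : ℝ → (UnitAddTorus (Fin 3)) → ℝ),
      IsClassicalNSSolutionOn (Ioc 0 3) ν (fun _ => force S c) u p ∧ (∀ t ∈ Ioc (0 : ℝ) 3, HasZeroMean (u t)) ∧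
      (∀ t ∈ Ioc (0 : ℝ) 3, gradNormSq (u t) ≤ E₂) ∧ (∀ t ∈ Ioc (0 : ℝ) 3, F.S (F.modelMap ν xF U' t y) = stateOf (u t)) ∧
      Tendsto (fun t => ∫ x, ‖u t x - rep (F.S y) x‖ ^ 2) (𝓝[>] 0) (𝓝 0) ∧
      Tendsto (fun t => eGradNormSq (u t - rep (F.S y))) (𝓝[>] 0) (𝓝 0) := by
  have _ := hU'
  have _ := hUU'
  obtain ⟨B, hB⟩ := hbdd.exists_norm_le
  obtain ⟨E₂, hE₂⟩ := ModelFrame.exists_classical_of_isMild hν F xF hxF B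
  refine ⟨E₂, fun y hy => ?_⟩
  have h3 : (3 : ℝ) ∈ Icc (0 : ℝ) 3 := ⟨by norm_num, le_rfl⟩
  obtain ⟨h03, ζ, hζ, hζU, -⟩ := htube y hy 3 h3
  have hg : ∀ (t : ℝ) (ht : t ∈ Ioc (0 : ℝ) 3), F.modelMap ν xF U' t y = ζ ⟨t, ht.1.le, ht.2⟩ := fun t ht => by
    obtain ⟨z', hz', hz'eq⟩ := hζ.restrict ht.1.le ht.2
    rw [F.modelMap_eq_of_isMild hν ht.1.le hz' fun r => (hz'eq r).symm ▸ hζU _, hz'eq]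
  obtain ⟨u, p, hu, hum, huM, huid, h0, h1⟩ := hE₂ (by norm_num : (0 : ℝ) < 3) hζ fun r => hB _ (hζU r)
  exact ⟨u, p, hu, hum, huM, fun t ht => (hg t ht).symm ▸ huid t ht, h0, h1⟩

/-- **Orbit segments staying in `U` are classical for positive times.**  In the setting of `stub_tubeOrbitClassicalTools`,
with the uniform level `E₂`: if `y ∈ U`, `T > 0` and the model orbit of `y` stays in `U` on `[0, T]`, then on `(0, T]` it is
the frame image of a classical mean-zero solution with `‖∇u(t)‖₂² ≤ E₂` attaining `rep (F.S y)` at `0⁺` (the admissible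
solution on `[0, T]` of `exists_isMild_of_forall_modelMap_mem` fed to `ModelFrame.exists_classical_of_isMild`). [folklore] -/
theorem ModelFrame.exists_classical_of_orbit {S : Finset (Fin 3 → ℤ)} {c : ↥S → (EuclideanSpace ℂ (Fin 3))} {ν : ℝ}
    (hν : 0 < ν) (F : ModelFrame) (xF : Hsp) (hxF : F.S xF = stateOf (force S c)) {U U' : Set Hsp}
    (hbdd : Bornology.IsBounded U') (hUU' : U ⊆ U')
    (htube : ∀ y ∈ U, ∀ t ∈ Icc (0 : ℝ) 3, ∃ (ht : 0 ≤ t) (z : C(Icc (0 : ℝ) t, Hsp)),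
      F.IsMild ν xF ht y z ∧ (∀ r, z r ∈ U') ∧ F.modelMap ν xF U' t y = z ⟨t, ht, le_rfl⟩) :
    ∃ E₂ : ℝ, ∀ y ∈ U, ∀ T : ℝ, 0 < T → (∀ t ∈ Icc 0 T, F.modelMap ν xF U' t y ∈ U) →
      ∃ (u : ℝ → (UnitAddTorus (Fin 3)) → (EuclideanSpace ℝ (Fin 3))) (p : ℝ → (UnitAddTorus (Fin 3)) → ℝ),
        IsClassicalNSSolutionOn (Ioc 0 T) ν (fun _ => force S c) u p ∧ (∀ t ∈ Ioc 0 T, HasZeroMean (u t)) ∧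
        (∀ t ∈ Ioc 0 T, gradNormSq (u t) ≤ E₂) ∧ (∀ t ∈ Ioc 0 T, F.S (F.modelMap ν xF U' t y) = stateOf (u t)) ∧
        Tendsto (fun t => ∫ x, ‖u t x - rep (F.S y) x‖ ^ 2) (𝓝[>] 0) (𝓝 0) ∧
        Tendsto (fun t => eGradNormSq (u t - rep (F.S y))) (𝓝[>] 0) (𝓝 0) := by
  obtain ⟨B, hB⟩ := hbdd.exists_norm_le
  obtain ⟨E₂, hE₂⟩ := ModelFrame.exists_classical_of_isMild hν F xF hxF B
  refine ⟨E₂, fun y hy T hT horb => ?_⟩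
  have htube' : ∀ y ∈ U, ∀ t ∈ Icc (0 : ℝ) 3, ∃ (ht : 0 ≤ t) (z : C(Icc (0 : ℝ) t, Hsp)),
      F.IsMild ν xF ht y z ∧ ∀ r, z r ∈ U' := fun y hy t ht => by
    obtain ⟨ht0, z, hz, hzU, -⟩ := htube y hy t ht
    exact ⟨ht0, z, hz, hzU⟩
  obtain ⟨ζ, hζ, hζU⟩ := F.exists_isMild_of_forall_modelMap_mem hν hUU' htube' ⌈T⌉₊ hT.le
    ((Nat.le_ceil T).trans (le_mul_of_one_le_left (Nat.cast_nonneg _) (by norm_num))) hy horb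
  have hg : ∀ (t : ℝ) (ht : t ∈ Ioc 0 T), F.modelMap ν xF U' t y = ζ ⟨t, ht.1.le, ht.2⟩ := fun t ht => by
    obtain ⟨z', hz', hz'eq⟩ := hζ.restrict ht.1.le ht.2
    rw [F.modelMap_eq_of_isMild hν ht.1.le hz' fun r => (hz'eq r).symm ▸ hζU _, hz'eq]
  obtain ⟨u, p, hu, hum, huM, huid, h0, h1⟩ := hE₂ hT hζ fun r => hB _ (hζU r)
  exact ⟨u, p, hu, hum, huM, fun t ht => (hg t ht).symm ▸ huid t ht, h0, h1⟩

end Summit.AnomalousDissipation.AnomalousDissipation.Theorems.DenseLoudDesignerForces.Ergodic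

end
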